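import Summits.BirchSwinnertonDyer.Rank1Residual.O5.FlexNFIsogenousCaseSKodairaLawThreeCells
import Summits.BirchSwinnertonDyer.Rank1Residual.Additive.KodairaCondExpThree
import Summits.BirchSwinnertonDyer.BirchSwinnertonDyer.Theorems.Rank2ObservatoryConductorCert
import Literature.NumberTheory.DiophantineGeometry.GeneralizedFermatTwoPowerCoefficientFreyProofs
import Literature.NumberTheory.EllipticCurves.RootNumberProofs
import HarnessLib

/-!
# The `Iₙ*` TAILS of the flex normal form at `3` (Case N) and the NEGATIVE EDGES of the two Case-N nodes:
# T30.4 `O5.FlexNormalForm.FlexNFCaseNKodairaLawThree` and T31-N `…Isogenous.FlexNFIsogenousCaseNKodairaLawThree`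
# are FALSE AS TYPED (a fuel artefact: `cellN` / `isoN` read `w := ord3 64 (b³ − A₃) = min(v₃, 64)` inside a
# ∀-statement) — kernel refutations with the witness `b = 1`, `A₃ = 1 − 3⁶⁵`
# (cell `b2b-bsdres`, team n1011, ROW T-FLEX-KOD, the lane's fourth file F3⁻; seat `b2b-bsdres-n1011-p18` GEN 13;
#  filed on cc-typer-5's BY-NAME pid ask HOME/INBOX 2026-08-22T15:55Z and the n1011 lead's authorisation R5-131;
#  theorems only; nothing of the typer's files edited — the ERRATUM banner, the `@[conjecture]` drop and the v2
#  VAL-law nodes `FlexNFCaseNKodairaValLawThree` / `FlexNFIsogenousCaseNKodairaValLawThree` are cc-typer-5's (c28))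

HONEST FRAMING (cell `b2b-bsdres`, run/shared/lean/b2b/bsd-rank1-residual/, verbatim in every file): the
goal of the cell is to DELETE the COMBINATION-SHAPED residual classes of the Birch–Swinnerton-Dyer formula
for ALL analytic-rank `≤ 1` elliptic curves over `ℚ` — "full BSD formula for every rank `≤ 1` curve in
class `C`" assembled STRICTLY from published theorems — so that the rank-`≤ 1` remainder becomes exactly
the CONSTRUCTION-SHAPED classes, which are TYPED (missing-input `Prop`s), NOT attempted. This is not
"finishing BSD". Lane CLASS-CLOSURE / O5 (O5 OPEN): research route; census output (P-K19 / P-K20) is EVIDENCE,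
never a Literature fact; nothing is booked; no mark of `RESIDUAL-MAP.md` moves. This file: THEOREMS ONLY (no
definition, no named fact, no `@[conjecture]` node, no `sorry`; net named-fact debt `0`). A refutation of an
EVIDENCE-labelled `@[conjecture]` node AS TYPED moves no class row and books nothing; the LAW itself survives
re-typed with the true valuation (the typer's v2 nodes), for which the tails below are the `w ≥ 4` halves.

## What is proved

* §1 **`FlexNormalForm.kodairaSymbolAt_and_ord_nfQ_zero_tail`** — T30.4's `Iₙ*` tail with the TRUE valuation:
  for `b ≡ A₃ ≡ 1 (mod 3)`, `3ʷ ∥ b³ − A₃`, `w ≥ 4`, the curve `nfQ b A₃ 0 : y² + 3b·xy + A₃y = x³` has Kodaira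
  type `I*_{w−3}` at `3`, `v₃Δ_min = w + 3`, `f₃ = 2`.  NO `Iₙ*` sub-procedure: the integer model
  `[3b, 0, A₃, 0, 0]` has `3^{w+3} ∥ Δ`, `3² ∥ c₄` ⇒ minimal (*AEC* VII.1.1) and additive (VII.5.1(c),
  `Rank2Observatory…hasAdditiveReductionAt_of_dvd`); `v₃ j = 3 − w < 0` ⇒ potentially multiplicative ⇒ `Iₙ₊₁*`
  (`exists_kodairaSymbolAt_eq_Istar_succ_of_potMult_three`); `f₃ = 2` on the tame types
  (`condExpTwo_three_of_kodairaSymbolAt_tame`); Ogg's formula (the definition of `conductorExponent`) gives `n`.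
* §2 **`FlexNormalForm.not_flexNFCaseNKodairaLawThree : ¬ FlexNFCaseNKodairaLawThree`** — on `b = 1`,
  `A₃ = 1 − 3⁶⁵` (`A₃ % 3 = 1`, `b³ ≠ A₃`, `w = 65`) the typer's `cellN` says `I*₆₁` (`decide`), §1 says `I*₆₂`.
* §3 **`Isogenous.kodairaSymbolAt_and_ord_isoQ_zero_tail`** — T31-N's tail: under the same hypotheses the
  isogenous column `isoQ b A₃ 0 = [0, −27b², 0, 216bM, −432M²]` (`M = b³ − A₃`) is `I*_{3w−9}` at `3`,
  `v₃Δ_min = 3w − 3`, `f₃ = 2` — on the RESCALED integer model `[0, −3b², 0, 8b·3^{w−1}M₁, −16·3^{2w−3}M₁²]`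
  (`u = 3`; read back by FILE 2a's `kodairaSymbolAt_and_ordMinimalDiscriminant_of_smul_eq_baseChange`).
* §4 **`Isogenous.not_flexNFIsogenousCaseNKodairaLawThree : ¬ FlexNFIsogenousCaseNKodairaLawThree`** — same
  witness: `isoN` says `I*₁₈₃`, §3 says `I*₁₈₆`.

Not claimed: the remaining Case-N cells (II / III / IV / I₀*; III* / IV* / II* / II / I₀*) and the v2 VAL-law
`_holds` — drafted and banked (`HOME/b2b-bsdres-n1011-p18/g13/f3-drafts/`), filed against the typer's v2 nodes later.

References: J. H. Silverman, *Advanced Topics in the Arithmetic of Elliptic Curves*, GTM 151 (1994), IV.9.4,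
Table 4.1, IV.11.1 [SilvermanATAEC1994]; J. H. Silverman, *The Arithmetic of Elliptic Curves*, GTM 106 (2009),
VII.1 Remark 1.1, VII.5 Prop. 5.1 [SilvermanAEC2009]; o5-r1 GEN 13/14 T30 / T31 memos; cc-typer-5 GEN 16
HOME/INBOX 2026-08-22T15:10Z / 15:55Z (re-typing word and pid ask).
-/

open scoped NumberField

open IsDedekindDomain Rat.HeightOneSpectrum WeierstrassCurve NumberField
  Literature.NumberTheory.EllipticCurves Literature.NumberTheory.EllipticCurves.Rank1Residual
  Literature.NumberTheory.DiophantineGeometry Literature.NumberTheory.DiophantineGeometry.TateAlgorithm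
  Summit.BirchSwinnertonDyer.BirchSwinnertonDyer.Rank2Observatory.Tate
  Summit.BirchSwinnertonDyer.BirchSwinnertonDyer.Rank2Observatory.RootNumber
  Summit.BirchSwinnertonDyer.Rank1Residual Summit.BirchSwinnertonDyer.Rank1Residual.Additive

namespace Summit.BirchSwinnertonDyer.Rank1Residual.O5.FlexNormalForm

/-- `natGenerator (placeOf 3) = 3`. [folklore] -/
private theorem natGenerator_placeOf_three : natGenerator (Additive.placeOf 3) = 3 :=
  Literature.NumberTheory.EllipticCurves.Rat.natGenerator_primesEquiv_symm ⟨3, Nat.prime_three⟩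

/-- If `3 ∤ u` then `3ⁿ⁺¹ ∤ 3ⁿ·u`. [folklore] -/
private theorem not_pow_succ_dvd_pow_mul₀ {u : ℤ} (n : ℕ) (hu : ¬ (3 : ℤ) ∣ u) :
    ¬ (3 : ℤ) ^ (n + 1) ∣ 3 ^ n * u := by
  rintro ⟨k, hk⟩
  refine hu ⟨k, ?_⟩
  have h3 : (3 : ℤ) ^ n ≠ 0 := pow_ne_zero _ (by norm_num)
  apply mul_left_cancel₀ h3
  rw [hk, pow_succ]; ring

/-- `3ⁿ ∥ x` gives `padicValInt 3 x = n`. [folklore] -/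
private theorem padicValInt_eq_of_pexact {x : ℤ} {n : ℕ} (hx : x ≠ 0) (h : (3 : ℤ) ^ n ∣ x)
    (h' : ¬ (3 : ℤ) ^ (n + 1) ∣ x) : padicValInt 3 x = n := by
  have h1 : n ≤ padicValInt 3 x := by
    rcases (padicValInt_dvd_iff (p := 3) n x).mp (by exact_mod_cast h) with h0 | h0
    · exact absurd h0 hx
    · exact h0
  have h2 : ¬ n + 1 ≤ padicValInt 3 x := fun hle ↦
    h' (by exact_mod_cast (padicValInt_dvd_iff (p := 3) (n + 1) x).mpr (Or.inr hle))
  omega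

/-! ## §1 The `Iₙ*` tail of T30.4 (true valuation) -/

/-- **The `Iₙ*` tail of T30.4 (Case N), true valuation.**  Let `b, A₃ ∈ ℤ` with `A₃ ≡ 1 (mod 3)`,
`b ≡ 1 (mod 3)` and `3ʷ ∥ b³ − A₃` with `w ≥ 4`.  Then `nfQ b A₃ 0 : y² + 3b·xy + A₃y = x³` has at `3`
Kodaira type `I*_{w−3}`, `v₃(Δ_min) = w + 3` and `f₃ = 2`.  Proof: the integer model `[3b, 0, A₃, 0, 0]`
has `Δ = 27A₃³(b³ − A₃)` (`3^{w+3} ∥ Δ`) and `c₄ = 9b(b³ + 8(b³ − A₃))` (`3² ∥ c₄`), so it is minimal at `3`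
(`v₃c₄ < 4`, *AEC* VII.1.1), the reduction is additive (*AEC* VII.5.1(c)) and potentially multiplicative
(`v₃ j = 6 − (w + 3) < 0`), hence of type `Iₙ₊₁*` (`exists_kodairaSymbolAt_eq_Istar_succ_of_potMult_three`,
the `(−3)`-twist of a Tate curve); the tame types have `f₃ = 2` (`condExpTwo_three_of_kodairaSymbolAt_tame`),
and Ogg's formula `f = v(Δ_min) + 1 − (n + 6)` forces `n + 1 = w − 3`.
[cite: SilvermanATAEC1994, IV.9.4 Steps 6–7, Table 4.1 and IV.11.1] [cite: SilvermanAEC2009, VII.1 Remark 1.1, VII.5 Prop. 5.1] -/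
theorem kodairaSymbolAt_and_ord_nfQ_zero_tail (b A₃ : ℤ) (hA : A₃ % 3 = 1) (hb : b % 3 = 1) {w : ℕ}
    (hw : 4 ≤ w) (hM : (3 : ℤ) ^ w ∣ b ^ 3 - A₃) (hM' : ¬ (3 : ℤ) ^ (w + 1) ∣ b ^ 3 - A₃) :
    (nfQ b A₃ 0).kodairaSymbolAt (Additive.placeOf 3) = .Istar (w - 3) ∧
      (nfQ b A₃ 0).ordMinimalDiscriminant (Additive.placeOf 3) = w + 3 ∧
      (nfQ b A₃ 0).conductorExponent (Additive.placeOf 3) = 2 := by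
  haveI : Fact (Nat.Prime 3) := ⟨Nat.prime_three⟩
  -- units
  have hA3 : ¬ (3 : ℤ) ∣ A₃ := by
    intro h; have := Int.emod_emod_of_dvd A₃ (dvd_refl (3 : ℤ)); omega
  have hb3 : ¬ (3 : ℤ) ∣ b := by intro h; omega
  obtain ⟨M₁, hM₁⟩ := hM
  have hM₁u : ¬ (3 : ℤ) ∣ M₁ := fun ⟨k, hk⟩ ↦ hM' ⟨k, by rw [hM₁, hk, pow_succ]; ring⟩
  -- the integer model and its invariants
  set W₀ : WeierstrassCurve ℤ := nf (3 * b) (3 ^ 0 * A₃) with hW₀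
  have hWQ : nfQ b A₃ 0 = W₀.baseChange ℚ := by
    rw [hW₀]; ext <;> simp [nfQ, nf, WeierstrassCurve.baseChange, WeierstrassCurve.map]
  have eΔ' : W₀.Δ = 3 ^ (w + 3) * (A₃ ^ 3 * M₁) := by
    rw [hW₀, nf_Δ]
    have : ((3 : ℤ) * b) ^ 3 - 27 * (3 ^ 0 * A₃) = 3 ^ 3 * (b ^ 3 - A₃) := by ring
    rw [this, hM₁]; ring
  have hΔ : (3 : ℤ) ^ (w + 3) ∣ W₀.Δ := by rw [eΔ']; exact dvd_mul_right _ _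
  have hΔ' : ¬ (3 : ℤ) ^ (w + 3 + 1) ∣ W₀.Δ := by
    rw [eΔ']
    refine not_pow_succ_dvd_pow_mul₀ _ fun h ↦ ?_
    rcases Int.prime_three.dvd_or_dvd h with h | h
    · exact hA3 (Int.prime_three.dvd_of_dvd_pow h)
    · exact hM₁u h
  have hΔ0 : W₀.Δ ≠ 0 := by rintro h0; rw [h0] at hΔ'; exact hΔ' (dvd_zero _)
  -- `c₄ = 9 · (b · (b³ + 8·3ʷ M₁))`, `3² ∥ c₄`
  have ec₄ : W₀.c₄ = 3 ^ 2 * (b * (b ^ 3 + 8 * 3 ^ w * M₁)) := by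
    rw [hW₀, nf_c₄_three]
    have : (9 : ℤ) * b ^ 3 - 8 * (3 ^ 0 * A₃) = b ^ 3 + 8 * (b ^ 3 - A₃) := by ring
    rw [this, hM₁]; ring
  have hc₄u : ¬ (3 : ℤ) ∣ b * (b ^ 3 + 8 * 3 ^ w * M₁) := by
    intro h
    rcases Int.prime_three.dvd_or_dvd h with h | h
    · exact hb3 h
    · have h8 : (3 : ℤ) ∣ 8 * 3 ^ w * M₁ :=
        Dvd.intro (8 * 3 ^ (w - 1) * M₁) (by
          obtain ⟨k, hk⟩ : ∃ k, w = k + 1 := ⟨w - 1, by omega⟩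
          rw [hk, pow_succ]; simp; ring)
      have : (3 : ℤ) ∣ b ^ 3 := by simpa using dvd_sub h h8
      exact hb3 (Int.prime_three.dvd_of_dvd_pow this)
  have hc₄ : (3 : ℤ) ∣ W₀.c₄ := ⟨3 * (b * (b ^ 3 + 8 * 3 ^ w * M₁)), by rw [ec₄]; ring⟩
  have hc₄' : ¬ (3 : ℤ) ^ 4 ∣ W₀.c₄ := by
    rw [ec₄]; intro h
    exact not_pow_succ_dvd_pow_mul₀ 2 hc₄u ((pow_dvd_pow (3 : ℤ) (by norm_num : 3 ≤ 4)).trans h)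
  -- ellipticity, minimality at `placeOf 3`, additivity
  haveI hell : (W₀.baseChange ℚ).IsElliptic := by
    refine ⟨(show (W₀.baseChange ℚ).Δ ≠ 0 from ?_).isUnit⟩
    rw [baseChange_int_Δ, Int.cast_ne_zero]; exact hΔ0
  have hgen := natGenerator_placeOf_three
  have hmin : (W₀.baseChange ℚ).IsMinimalAt (Additive.placeOf 3) :=
    isMinimalAt_of_lt_valuation_c₄ (isIntegralAt_baseChange_int _ W₀)
      (by rw [baseChange_int_c₄]
          exact (Literature.NumberTheory.EllipticCurves.Rat.exp_lt_valuation_intCast_iff _ _ 4).mpr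
            (by rw [hgen]; exact_mod_cast hc₄'))
  have hadd' : (W₀.baseChange ℚ).HasAdditiveReductionAt (Additive.placeOf 3) :=
    hasAdditiveReductionAt_of_dvd (Additive.placeOf 3) (n := w + 3) (by omega)
      (by rw [hgen]; exact_mod_cast hΔ) (by rw [hgen]; exact_mod_cast hΔ')
      (Or.inr (by rw [hgen]; exact_mod_cast hc₄')) (by rw [hgen]; exact_mod_cast hc₄)
  have hadd : Addv (W₀.baseChange ℚ) 3 := by
    refine ⟨fun hg ↦ ?_, fun hm ↦ ?_⟩
    · have hg' : (W₀.baseChange ℚ).HasGoodReductionAt (Additive.placeOf 3) :=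
        ((W₀.baseChange ℚ).hasGoodReductionAtPrime_iff_hasGoodReductionAt_holds ⟨3, Nat.prime_three⟩).mp hg
      exact absurd hg'.goodReduction hadd'.badReduction.ne
    · have hm' : (W₀.baseChange ℚ).HasMultiplicativeReductionAt (Additive.placeOf 3) :=
        ((W₀.baseChange ℚ).hasMultiplicativeReductionAtPrime_iff_hasMultiplicativeReductionAt_holds
          ⟨3, Nat.prime_three⟩).mp hm
      exact absurd hm'.multiplicativeReduction hadd'.additiveReduction.ne
  -- `ord₃ Δ_min = w + 3`
  have hord : (W₀.baseChange ℚ).ordMinimalDiscriminant (Additive.placeOf 3) = w + 3 := by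
    rw [ordMinimalDiscriminant_eq_padicValInt_of_isMinimalAt hmin, hgen]
    exact padicValInt_eq_of_pexact hΔ0 hΔ hΔ'
  -- potentially multiplicative: `v₃ j = 6 − (w + 3) < 0`
  have hpm : PotMult (W₀.baseChange ℚ) 3 := by
    unfold PotMult
    have hj : (W₀.baseChange ℚ).j = ((W₀.c₄ : ℚ) ^ 3) / (W₀.Δ : ℚ) := by
      rw [WeierstrassCurve.j, Units.val_inv_eq_inv_val, WeierstrassCurve.coe_Δ', div_eq_inv_mul,
        baseChange_int_c₄, baseChange_int_Δ]
    have hc₄0 : W₀.c₄ ≠ 0 := by rintro h0; rw [h0] at hc₄'; exact hc₄' (dvd_zero _)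
    have hvc : padicValInt 3 W₀.c₄ = 2 :=
      padicValInt_eq_of_pexact hc₄0 (by rw [ec₄]; exact dvd_mul_right _ _)
        (by rw [ec₄]; exact not_pow_succ_dvd_pow_mul₀ 2 hc₄u)
    have hvΔ : padicValInt 3 W₀.Δ = w + 3 := padicValInt_eq_of_pexact hΔ0 hΔ hΔ'
    rw [hj, padicValRat.div (pow_ne_zero 3 (by exact_mod_cast hc₄0)) (by exact_mod_cast hΔ0),
      padicValRat.pow, padicValRat.of_int, padicValRat.of_int, hvc, hvΔ]
    push_cast; omega
  -- type `Iₙ₊₁*`, `f₃ = 2`, and Ogg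
  obtain ⟨n, hn⟩ := exists_kodairaSymbolAt_eq_Istar_succ_of_potMult_three (W₀.baseChange ℚ) hadd hpm
  have hf : CondExpTwo (W₀.baseChange ℚ) 3 :=
    condExpTwo_three_of_kodairaSymbolAt_tame (W₀.baseChange ℚ) (Or.inr (Or.inr ⟨_, hn⟩))
  have hf' : (W₀.baseChange ℚ).conductorExponent (Additive.placeOf 3) = 2 := hf
  have hnw : n + 1 = w - 3 := by
    have := hf'
    unfold WeierstrassCurve.conductorExponent WeierstrassCurve.numComponentsAt at this
    rw [hn, hord] at this
    simp only [KodairaSymbol.numComponents_Istar] at this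
    omega
  rw [hWQ]
  exact ⟨by rw [hn, hnw], hord, hf'⟩

/-! ## §2 The typed node T30.4 is FALSE (fuel artefact of `ord3 64`): witness `b = 1`, `A₃ = 1 − 3⁶⁵` -/

/-- **`FlexNFCaseNKodairaLawThree` (T30.4) is false AS TYPED** — refuted-MISSTATED, not a Tate slip: the
typer's `cellN` reads `w` through the fuel-bounded `ord3 64` (`ord3 64 x = min (v₃ x) 64`), so on
`b = 1`, `A₃ = 1 − 3⁶⁵` (`A₃ ≡ 1 (mod 3)`, `b³ ≠ A₃`, `v₃(b³ − A₃) = 65`) it predicts `I*₆₁`, while the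
curve is `I*₆₂` (`kodairaSymbolAt_and_ord_nfQ_zero_tail`).  REPAIR (the typer's pen): read `w` as the true
valuation `padicValInt 3 (b³ − A₃)` (or bind `v₃(b³ − A₃) ≤ 64`); with that reading every cell is a theorem.
[cite: SilvermanATAEC1994, IV.9.4] -/
theorem not_flexNFCaseNKodairaLawThree : ¬ FlexNFCaseNKodairaLawThree := by
  intro h
  have hA : (1 - 3 ^ 65 : ℤ) % 3 = 1 := by norm_num
  have hne : (1 : ℤ) ^ 3 ≠ 1 - 3 ^ 65 := by norm_num
  obtain ⟨hK, -⟩ := h 1 (1 - 3 ^ 65) hA hne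
  have hM : (3 : ℤ) ^ 65 ∣ 1 ^ 3 - (1 - 3 ^ 65) := ⟨1, by ring⟩
  have hM' : ¬ (3 : ℤ) ^ (65 + 1) ∣ 1 ^ 3 - (1 - 3 ^ 65) := by
    rw [show (1 : ℤ) ^ 3 - (1 - 3 ^ 65) = 3 ^ 65 * 1 by ring]
    exact not_pow_succ_dvd_pow_mul₀ 65 (by norm_num)
  obtain ⟨hK', -, -⟩ := kodairaSymbolAt_and_ord_nfQ_zero_tail 1 (1 - 3 ^ 65) hA (by norm_num)
    (by norm_num) hM hM'
  have hcell : (cellN 1 (1 - 3 ^ 65)).kod = .Istar 61 := by decide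
  rw [hK', hcell] at hK
  exact absurd hK (by decide)

end Summit.BirchSwinnertonDyer.Rank1Residual.O5.FlexNormalForm

namespace Summit.BirchSwinnertonDyer.Rank1Residual.O5.FlexNormalForm.Isogenous

/-! ## §3 The `Iₙ*` tail of T31-N (isogenous column) on the rescaled model -/

/-- **The `Iₙ*` tail of T31-N (isogenous column, Case N), true valuation.**  Let `b, A₃ ∈ ℤ` with
`A₃ ≡ b ≡ 1 (mod 3)`, `3ʷ ∥ M := b³ − A₃`, `w ≥ 4`.  Then `isoQ b A₃ 0 = [0, −27b², 0, 216bM, −432M²]` has at `3`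
Kodaira type `I*_{3(w−3)}`, `v₃(Δ_min) = 3w − 3` and `f₃ = 2`.  Proof: the given model is not minimal; the
rescaling `u = 3` gives the INTEGER model `R = [0, −3b², 0, 8b·3^{w−1}M₁, −16·3^{2w−3}M₁²]` (`M = 3ʷM₁`) with
`Δ(R) = 2¹²3^{3w−3}A₃M₁³` and `c₄(R) = 144·b·(b³ − 8·3^{w−2}M₁)` (`3² ∥ c₄`), hence minimal (`v₃c₄ < 4`), additive,
potentially multiplicative (`v₃ j = 6 − (3w − 3) < 0`) ⇒ `Iₙ₊₁*`; `f₃ = 2` on the tame types and Ogg give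
`n + 1 = 3w − 9`; the reading is carried back to `isoQ` along the `ℚ`-isomorphism (F2a's
`kodairaSymbolAt_and_ordMinimalDiscriminant_of_smul_eq_baseChange`, `conductorExponent` by definition).
[cite: SilvermanATAEC1994, IV.9.4 Steps 6–7, Table 4.1, IV.11.1] [cite: SilvermanAEC2009, VII.1 Remark 1.1 and VII.5 Prop. 5.1] -/
theorem kodairaSymbolAt_and_ord_isoQ_zero_tail (b A₃ : ℤ) (hA : A₃ % 3 = 1) (hb : b % 3 = 1) {w : ℕ}
    (hw : 4 ≤ w) (hM : (3 : ℤ) ^ w ∣ b ^ 3 - A₃) (hM' : ¬ (3 : ℤ) ^ (w + 1) ∣ b ^ 3 - A₃) :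
    (isoQ b A₃ 0).kodairaSymbolAt (Additive.placeOf 3) = .Istar (3 * w - 9) ∧
      (isoQ b A₃ 0).ordMinimalDiscriminant (Additive.placeOf 3) = 3 * w - 3 ∧
      (isoQ b A₃ 0).conductorExponent (Additive.placeOf 3) = 2 := by
  haveI : Fact (Nat.Prime 3) := ⟨Nat.prime_three⟩
  have hA3 : ¬ (3 : ℤ) ∣ A₃ := by
    intro h; have := (Int.dvd_iff_emod_eq_zero ..).mp h; omega
  have hb3 : ¬ (3 : ℤ) ∣ b := by
    intro h; have := (Int.dvd_iff_emod_eq_zero ..).mp h; omega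
  have hA0 : A₃ ≠ 0 := by rintro rfl; exact hA3 (dvd_zero _)
  obtain ⟨M₁, hM₁⟩ := hM
  have hM₁u : ¬ (3 : ℤ) ∣ M₁ := fun ⟨k, hk⟩ ↦ hM' ⟨k, by rw [hM₁, hk, pow_succ]; ring⟩
  have hM₁0 : M₁ ≠ 0 := by rintro rfl; exact hM₁u (dvd_zero _)
  obtain ⟨w', rfl⟩ : ∃ w', w = w' + 4 := ⟨w - 4, by omega⟩
  have hA₃ : A₃ = b ^ 3 - 3 ^ (w' + 4) * M₁ := by linear_combination -hM₁
  subst hA₃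
  -- the rescaled integer model
  set R₀ : WeierstrassCurve ℤ :=
    ⟨0, -(3 * b ^ 2), 0, 8 * b * 3 ^ (w' + 3) * M₁, -(16 * 3 ^ (2 * w' + 5) * M₁ ^ 2)⟩ with hR₀
  haveI hell : (isoQ b (b ^ 3 - 3 ^ (w' + 4) * M₁) 0).IsElliptic := by
    refine ⟨(show (isoQ b (b ^ 3 - 3 ^ (w' + 4) * M₁) 0).Δ ≠ 0 from ?_).isUnit⟩
    rw [isoQ, isoModel_Δ]
    push_cast
    have : (M₁ : ℚ) ≠ 0 := by exact_mod_cast hM₁0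
    have : ((b : ℚ) ^ 3 - 3 ^ (w' + 4) * (M₁ : ℚ)) ≠ 0 := by exact_mod_cast hA0
    have e : ((b : ℚ) ^ 3 - ((b : ℚ) ^ 3 - 3 ^ 0 * ((b : ℚ) ^ 3 - 3 ^ (w' + 4) * (M₁ : ℚ)))) =
        ((b : ℚ) ^ 3 - 3 ^ (w' + 4) * (M₁ : ℚ)) := by ring
    have e' : ((b : ℚ) ^ 3 - 3 ^ 0 * ((b : ℚ) ^ 3 - 3 ^ (w' + 4) * (M₁ : ℚ))) = 3 ^ (w' + 4) * (M₁ : ℚ) := by ring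
    rw [e, e']
    positivity
  have hrel : (⟨Units.mk0 (3 : ℚ) (by norm_num), 0, 0, 0⟩ : VariableChange ℚ) •
      isoQ b (b ^ 3 - 3 ^ (w' + 4) * M₁) 0 = R₀.baseChange ℚ := by
    ext <;> simp [variableChange_a₁, variableChange_a₂, variableChange_a₃, variableChange_a₄,
      variableChange_a₆, isoQ, isoModel, hR₀, WeierstrassCurve.baseChange, WeierstrassCurve.map] <;>
      ring
  -- invariants of `R₀`
  have eΔ : R₀.Δ = 3 ^ (3 * w' + 9) * (2 ^ 12 * ((b ^ 3 - 3 ^ (w' + 4) * M₁) * M₁ ^ 3)) := by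
    simp only [hR₀, WeierstrassCurve.Δ, WeierstrassCurve.b₂, WeierstrassCurve.b₄, WeierstrassCurve.b₆,
      WeierstrassCurve.b₈]
    ring
  have hΔ : (3 : ℤ) ^ (3 * w' + 9) ∣ R₀.Δ := by rw [eΔ]; exact dvd_mul_right _ _
  have hΔ' : ¬ (3 : ℤ) ^ (3 * w' + 9 + 1) ∣ R₀.Δ := by
    rw [eΔ]
    refine not_pow_succ_dvd_pow_mul' _ (not_three_dvd_mul not_three_dvd_two_pow
      (not_three_dvd_mul hA3 (not_three_dvd_pow hM₁u 3)))
  have hΔ0 : R₀.Δ ≠ 0 := by rintro h0; rw [h0] at hΔ'; exact hΔ' (dvd_zero _)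
  have ec₄ : R₀.c₄ = 3 ^ 2 * (16 * b * (b ^ 3 - 8 * 3 ^ (w' + 2) * M₁)) := by
    simp only [hR₀, WeierstrassCurve.c₄, WeierstrassCurve.b₂, WeierstrassCurve.b₄]; ring
  have hc₄u : ¬ (3 : ℤ) ∣ 16 * b * (b ^ 3 - 8 * 3 ^ (w' + 2) * M₁) := by
    intro h
    rcases Int.prime_three.dvd_or_dvd h with h | h
    · rcases Int.prime_three.dvd_or_dvd h with h | h
      · exact absurd h (by decide)
      · exact hb3 h
    · have h8 : (3 : ℤ) ∣ 8 * 3 ^ (w' + 2) * M₁ := ⟨8 * 3 ^ (w' + 1) * M₁, by ring⟩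
      have : (3 : ℤ) ∣ b ^ 3 := by simpa using dvd_add h h8
      exact hb3 (Int.prime_three.dvd_of_dvd_pow this)
  have hc₄ : (3 : ℤ) ∣ R₀.c₄ := ⟨3 * (16 * b * (b ^ 3 - 8 * 3 ^ (w' + 2) * M₁)), by rw [ec₄]; ring⟩
  have hc₄' : ¬ (3 : ℤ) ^ 4 ∣ R₀.c₄ := by
    rw [ec₄]; intro h
    exact not_pow_succ_dvd_pow_mul' 2 hc₄u ((pow_dvd_pow (3 : ℤ) (by norm_num : 3 ≤ 4)).trans h)
  haveI hellR : (R₀.baseChange ℚ).IsElliptic := by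
    refine ⟨(show (R₀.baseChange ℚ).Δ ≠ 0 from ?_).isUnit⟩
    rw [baseChange_int_Δ, Int.cast_ne_zero]; exact hΔ0
  have hgen : natGenerator (Additive.placeOf 3) = 3 :=
    Literature.NumberTheory.EllipticCurves.Rat.natGenerator_primesEquiv_symm ⟨3, Nat.prime_three⟩
  have hmin : (R₀.baseChange ℚ).IsMinimalAt (Additive.placeOf 3) :=
    isMinimalAt_of_lt_valuation_c₄ (isIntegralAt_baseChange_int _ R₀)
      (by rw [baseChange_int_c₄]
          exact (Literature.NumberTheory.EllipticCurves.Rat.exp_lt_valuation_intCast_iff _ _ 4).mpr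
            (by rw [hgen]; exact_mod_cast hc₄'))
  have hadd' : (R₀.baseChange ℚ).HasAdditiveReductionAt (Additive.placeOf 3) :=
    hasAdditiveReductionAt_of_dvd (Additive.placeOf 3) (n := 3 * w' + 9) (by omega)
      (by rw [hgen]; exact_mod_cast hΔ) (by rw [hgen]; exact_mod_cast hΔ')
      (Or.inr (by rw [hgen]; exact_mod_cast hc₄')) (by rw [hgen]; exact_mod_cast hc₄)
  have hadd : Addv (R₀.baseChange ℚ) 3 := by
    refine ⟨fun hg ↦ ?_, fun hm ↦ ?_⟩
    · have hg' : (R₀.baseChange ℚ).HasGoodReductionAt (Additive.placeOf 3) :=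
        ((R₀.baseChange ℚ).hasGoodReductionAtPrime_iff_hasGoodReductionAt_holds ⟨3, Nat.prime_three⟩).mp hg
      exact absurd hg'.goodReduction hadd'.badReduction.ne
    · have hm' : (R₀.baseChange ℚ).HasMultiplicativeReductionAt (Additive.placeOf 3) :=
        ((R₀.baseChange ℚ).hasMultiplicativeReductionAtPrime_iff_hasMultiplicativeReductionAt_holds
          ⟨3, Nat.prime_three⟩).mp hm
      exact absurd hm'.multiplicativeReduction hadd'.additiveReduction.ne
  have hord : (R₀.baseChange ℚ).ordMinimalDiscriminant (Additive.placeOf 3) = 3 * w' + 9 := by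
    rw [ordMinimalDiscriminant_eq_padicValInt_of_isMinimalAt hmin, hgen]
    exact padicValInt_eq_of_pexact hΔ0 hΔ hΔ'
  have hpm : PotMult (R₀.baseChange ℚ) 3 := by
    unfold PotMult
    have hj : (R₀.baseChange ℚ).j = ((R₀.c₄ : ℚ) ^ 3) / (R₀.Δ : ℚ) := by
      rw [WeierstrassCurve.j, Units.val_inv_eq_inv_val, WeierstrassCurve.coe_Δ', div_eq_inv_mul,
        baseChange_int_c₄, baseChange_int_Δ]
    have hc₄0 : R₀.c₄ ≠ 0 := by rintro h0; rw [h0] at hc₄'; exact hc₄' (dvd_zero _)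
    have hvc : padicValInt 3 R₀.c₄ = 2 :=
      padicValInt_eq_of_pexact hc₄0 (by rw [ec₄]; exact dvd_mul_right _ _)
        (by rw [ec₄]; exact not_pow_succ_dvd_pow_mul' 2 hc₄u)
    have hvΔ : padicValInt 3 R₀.Δ = 3 * w' + 9 := padicValInt_eq_of_pexact hΔ0 hΔ hΔ'
    rw [hj, padicValRat.div (pow_ne_zero 3 (by exact_mod_cast hc₄0)) (by exact_mod_cast hΔ0),
      padicValRat.pow, padicValRat.of_int, padicValRat.of_int, hvc, hvΔ]
    push_cast; omega
  obtain ⟨n, hn⟩ := exists_kodairaSymbolAt_eq_Istar_succ_of_potMult_three (R₀.baseChange ℚ) hadd hpm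
  have hf : (R₀.baseChange ℚ).conductorExponent (Additive.placeOf 3) = 2 :=
    condExpTwo_three_of_kodairaSymbolAt_tame (R₀.baseChange ℚ) (Or.inr (Or.inr ⟨_, hn⟩))
  have hnw : n + 1 = 3 * (w' + 4) - 9 := by
    have := hf
    unfold WeierstrassCurve.conductorExponent WeierstrassCurve.numComponentsAt at this
    rw [hn, hord] at this
    simp only [KodairaSymbol.numComponents_Istar] at this
    omega
  have hR : (R₀.baseChange ℚ).kodairaSymbolAt (Additive.placeOf 3) = .Istar (3 * (w' + 4) - 9) ∧
      (R₀.baseChange ℚ).ordMinimalDiscriminant (Additive.placeOf 3) = 3 * (w' + 4) - 3 :=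
    ⟨by rw [hn, hnw], by rw [hord]; omega⟩
  obtain ⟨hK, hO⟩ := kodairaSymbolAt_and_ordMinimalDiscriminant_of_smul_eq_baseChange _ _ R₀ hrel hR
  refine ⟨hK, hO, ?_⟩
  unfold WeierstrassCurve.conductorExponent WeierstrassCurve.numComponentsAt
  rw [hK, hO]; simp only [KodairaSymbol.numComponents_Istar]; omega


/-! ## §4 The typed node T31-N is FALSE (same fuel artefact): witness `b = 1`, `A₃ = 1 − 3⁶⁵` -/

/-- **`FlexNFIsogenousCaseNKodairaLawThree` (T31 Case N) is false AS TYPED** — refuted-MISSTATED (the same fuel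
artefact as T30.4): on `b = 1`, `A₃ = 1 − 3⁶⁵` the typer's `isoN` predicts `I*₁₈₃` (`ord3 64` caps `w` at `64`),
while the curve is `I*₁₈₆` (`kodairaSymbolAt_and_ord_isoQ_zero_tail`, `w = 65`).  REPAIR: the v2 node reading
`isoNAt b A₃ (padicValInt 3 (b³ − A₃))` (cc-typer-5 GEN 16). [cite: SilvermanATAEC1994, IV.9.4] -/
theorem not_flexNFIsogenousCaseNKodairaLawThree : ¬ FlexNFIsogenousCaseNKodairaLawThree := by
  intro h
  have hA : (1 - 3 ^ 65 : ℤ) % 3 = 1 := by norm_num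
  have hne : (1 : ℤ) ^ 3 ≠ 1 - 3 ^ 65 := by norm_num
  obtain ⟨hK, -⟩ := h 1 (1 - 3 ^ 65) hA hne
  have hM : (3 : ℤ) ^ 65 ∣ 1 ^ 3 - (1 - 3 ^ 65) := ⟨1, by ring⟩
  have hM' : ¬ (3 : ℤ) ^ (65 + 1) ∣ 1 ^ 3 - (1 - 3 ^ 65) := by
    rw [show (1 : ℤ) ^ 3 - (1 - 3 ^ 65) = 3 ^ 65 * 1 by ring]
    exact not_pow_succ_dvd_pow_mul' 65 (by norm_num)
  obtain ⟨hK', -, -⟩ := kodairaSymbolAt_and_ord_isoQ_zero_tail 1 (1 - 3 ^ 65) hA (by norm_num)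
    (by norm_num) hM hM'
  have hcell : (isoN 1 (1 - 3 ^ 65)).kod = .Istar 183 := by decide
  rw [hK', hcell] at hK
  exact absurd hK (by decide)

end Summit.BirchSwinnertonDyer.Rank1Residual.O5.FlexNormalForm.Isogenous
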